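import Literature.Geometry.Symplectic.JPlanePencilCorePositivity
import Literature.Geometry.Symplectic.JPlanePencilUniqueContinuation
import Literature.Geometry.Symplectic.JPlanePencilMemberSphere
import Literature.Geometry.Symplectic.SphereIntersectionIndexHomologicalNoncompact
import Literature.Geometry.Symplectic.JSphereFamilyLeafFunction
import Mathlib.Analysis.SpecialFunctions.SmoothTransition
import HarnessLib

/-!
# Universality of a local pencil family on a homotopy 4-sphere (Wendl Prop. 2.53, `m = 1`)

Support theorems (no named facts, D-0026) for
`Literature.Geometry.Symplectic.jPlanePencil_localFamily_homotopySphere`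
(`JPlanePencilLocalFamily.lean`; C. Wendl, *Holomorphic Curves in Low Dimensions* (2018),
Prop. 2.53 with `m = 1`, for homotopy 4-spheres).

This file proves the UNIVERSALITY clause of the fact from the EXISTENCE of a smooth immersive
local family `b' ↦ Floc b'` of members through the intercepts near `b`, plus two first-order
properties of the family near the constraint point `p` (the overlap comparison `hG` and the
orientation `hS` of the family parameter at far points), following Wendl's proof of Prop. 2.53
with Thm. 2.49 ("positivity of intersections: two curves of the family are identical or
disjoint away from the constraint, where the constrained intersection index is `m − 1`;
homological intersection numbers vanish on a homotopy sphere"): for a test member `u` of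
intercept `b`, either `u = Floc b` (unique continuation, `JPlanePencilUniqueContinuation.lean`)
or the crossings of `u` with `K = Floc b(ℂ) ∪ {p}` are finitely many core crossings of local
index `≥ 1` (`corePositivity_dichotomy`) plus the constrained crossing at `p` of index
`m − 1 ≥ 1` (`IsPencilPlane.constraintIndex_dichotomy`), while their sum is the value on
`u_*[ℂℙ¹] = 0 ∈ H₂(M) = 0` of the homological index functional of a glued defining function of
`K` (`sphere_zeroSetIndex_factorsThroughHomology_of_isClosed`) — a contradiction.

Contents: a smooth radial cut-off at `p` (§1), topological bookkeeping for `K` and the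
punctured manifold (§2–§3), and the universality theorem (§4).

## References

* C. Wendl, *Holomorphic Curves in Low Dimensions*, LNM 2216, Springer (2018), Prop. 2.53,
  Thm. 2.49, Thm. 2.46, Appendix B. [Wendl2018]
* D. McDuff, *The local behaviour of holomorphic curves in almost complex 4-manifolds*,
  J. Differential Geom. 34 (1991). [McDuff1991LocalBehaviour]
-/

noncomputable section

open scoped Manifold ContDiff Topology ComplexConjugate
open Set Function Filter Metric Complex Literature.Topology.PlaneTopology

namespace Literature.Geometry.Symplectic

/-! ### §1 A smooth radial cut-off at the constraint point -/

section Cutoff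

variable {M : Type} [TopologicalSpace M] [T2Space M]
  [ChartedSpace (EuclideanSpace ℝ (Fin 4)) M] [IsManifold (𝓡 4) ∞ M] {p : M}

/-- The chart distance to `p` (squared): `y ↦ ‖e y − e p‖²`. [folklore] -/
def chartDistSq (p : M) (y : M) : ℝ := ‖extChartAt (𝓡 4) p y - extChartAt (𝓡 4) p p‖ ^ 2

open Classical in
/-- The radial cut-off at scale `s`: `0` where `‖e y − e p‖ ≤ s`, `1` where `‖e y − e p‖ ≥ 2s`
or off the chart source, smooth transition in between. [folklore] -/
def radialCutoff (p : M) (s : ℝ) (y : M) : ℝ :=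
  if y ∈ (chartAt (EuclideanSpace ℝ (Fin 4)) p).source then
    Real.smoothTransition ((chartDistSq p y - s ^ 2) / (3 * s ^ 2))
  else 1

omit [T2Space M] [IsManifold (𝓡 4) ∞ M] in
/-- The cut-off vanishes on the closed chart ball of radius `s`. [folklore] -/
theorem radialCutoff_eq_zero {s : ℝ} (hs : 0 < s) {y : M}
    (hy : y ∈ (chartAt (EuclideanSpace ℝ (Fin 4)) p).source)
    (hd : ‖extChartAt (𝓡 4) p y - extChartAt (𝓡 4) p p‖ ≤ s) : radialCutoff p s y = 0 := by
  rw [radialCutoff, if_pos hy]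
  apply Real.smoothTransition.zero_of_nonpos
  apply div_nonpos_of_nonpos_of_nonneg _ (by positivity)
  have : chartDistSq p y ≤ s ^ 2 := by
    rw [chartDistSq]; exact pow_le_pow_left₀ (norm_nonneg _) hd 2
  linarith

omit [T2Space M] [IsManifold (𝓡 4) ∞ M] in
/-- The cut-off is `1` off the open chart ball of radius `2s` (and off the source). [folklore] -/
theorem radialCutoff_eq_one {s : ℝ} (hs : 0 < s) {y : M}
    (hd : y ∈ (chartAt (EuclideanSpace ℝ (Fin 4)) p).source →
      2 * s ≤ ‖extChartAt (𝓡 4) p y - extChartAt (𝓡 4) p p‖) : radialCutoff p s y = 1 := by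
  rw [radialCutoff]
  split_ifs with hy
  · apply Real.smoothTransition.one_of_one_le
    rw [le_div_iff₀ (by positivity), one_mul]
    have h2 := hd hy
    have : (2 * s) ^ 2 ≤ chartDistSq p y := by
      rw [chartDistSq]; exact pow_le_pow_left₀ (by positivity) h2 2
    nlinarith
  · rfl

omit [T2Space M] [IsManifold (𝓡 4) ∞ M] in
/-- `0 ≤ ρ`. [folklore] -/
theorem radialCutoff_nonneg (s : ℝ) (y : M) : 0 ≤ radialCutoff p s y := by
  rw [radialCutoff]; split_ifs
  · exact Real.smoothTransition.nonneg _
  · exact zero_le_one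

omit [T2Space M] [IsManifold (𝓡 4) ∞ M] in
/-- `ρ ≤ 1`. [folklore] -/
theorem radialCutoff_le_one (s : ℝ) (y : M) : radialCutoff p s y ≤ 1 := by
  rw [radialCutoff]; split_ifs
  · exact Real.smoothTransition.le_one _
  · exact le_rfl

omit [T2Space M] in
/-- The squared chart distance is smooth on the chart source. [folklore] -/
theorem contMDiffOn_chartDistSq :
    ContMDiffOn (𝓡 4) 𝓘(ℝ, ℝ) ∞ (chartDistSq p)
      (chartAt (EuclideanSpace ℝ (Fin 4)) p).source := by
  have h1 : ContMDiffOn (𝓡 4) 𝓘(ℝ, EuclideanSpace ℝ (Fin 4)) ∞ (extChartAt (𝓡 4) p)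
      (chartAt (EuclideanSpace ℝ (Fin 4)) p).source := contMDiffOn_extChartAt
  have h2 : ContDiff ℝ ∞ fun x : EuclideanSpace ℝ (Fin 4) => ‖x - extChartAt (𝓡 4) p p‖ ^ 2 :=
    (contDiff_norm_sq ℝ).comp (contDiff_id.sub contDiff_const)
  exact fun y hy => h2.comp_contMDiffWithinAt (h1 y hy)

/-- **The radial cut-off is smooth** once `2s ≤ ε` for a closed chart ball `closedBall (e p) ε`
inside the target (then it is `1` near every point off the compact `e⁻¹(closedBall (e p) ε)`).
[folklore] -/
theorem contMDiff_radialCutoff {s ε : ℝ} (hs : 0 < s) (hsε : 2 * s ≤ ε)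
    (hεt : closedBall (extChartAt (𝓡 4) p p) ε ⊆ (extChartAt (𝓡 4) p).target) :
    ContMDiff (𝓡 4) 𝓘(ℝ, ℝ) ∞ (radialCutoff p s) := by
  intro y
  set e := extChartAt (𝓡 4) p with he
  set Kc : Set M := e.symm '' closedBall (e p) ε with hKc
  have hKc_cpt : IsCompact Kc := by
    refine (isCompact_closedBall (e p) ε).image_of_continuousOn ?_
    exact (continuousOn_extChartAt_symm p).mono hεt
  have hsrc : (chartAt (EuclideanSpace ℝ (Fin 4)) p).source = e.source := by
    rw [he, extChartAt_source]
  by_cases hy : y ∈ (chartAt (EuclideanSpace ℝ (Fin 4)) p).source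
  · -- on the chart source the cut-off is the smooth formula
    have hopen : IsOpen (chartAt (EuclideanSpace ℝ (Fin 4)) p).source := (chartAt _ p).open_source
    have hev : radialCutoff p s =ᶠ[𝓝 y]
        fun y => Real.smoothTransition ((chartDistSq p y - s ^ 2) / (3 * s ^ 2)) := by
      filter_upwards [hopen.mem_nhds hy] with y' hy'
      rw [radialCutoff, if_pos hy']
    refine ContMDiffAt.congr_of_eventuallyEq ?_ hev
    have h1 : ContMDiffAt (𝓡 4) 𝓘(ℝ, ℝ) ∞ (chartDistSq p) y :=
      (contMDiffOn_chartDistSq y hy).contMDiffAt (hopen.mem_nhds hy)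
    have h2 : ContDiff ℝ ∞ fun x : ℝ => Real.smoothTransition ((x - s ^ 2) / (3 * s ^ 2)) :=
      Real.smoothTransition.contDiff.comp ((contDiff_id.sub contDiff_const).div_const _)
    exact h2.comp_contMDiffAt h1
  · -- off the source: `y ∉ Kc`, and the cut-off is `1` near `y`
    have hyK : y ∉ Kc := by
      rintro ⟨x, hx, rfl⟩
      exact hy (hsrc ▸ e.map_target (hεt hx))
    have hev : radialCutoff p s =ᶠ[𝓝 y] fun _ => (1 : ℝ) := by
      filter_upwards [hKc_cpt.isClosed.isOpen_compl.mem_nhds hyK] with y' hy'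
      apply radialCutoff_eq_one hs
      intro hy's
      by_contra hlt
      push Not at hlt
      apply hy'
      refine ⟨e y', ?_, e.left_inv (hsrc ▸ hy's)⟩
      rw [mem_closedBall, dist_eq_norm]
      linarith
    exact contMDiffAt_const.congr_of_eventuallyEq hev

omit [IsManifold (𝓡 4) ∞ M] in
/-- Near a point off the closed chart ball of radius `2s` the cut-off is identically `1`.
[folklore] -/
theorem radialCutoff_eventually_eq_one {s ε : ℝ} (hs : 0 < s) (hsε : 2 * s ≤ ε)
    (hεt : closedBall (extChartAt (𝓡 4) p p) ε ⊆ (extChartAt (𝓡 4) p).target) {y : M}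
    (hy : y ∈ (chartAt (EuclideanSpace ℝ (Fin 4)) p).source →
      2 * s < ‖extChartAt (𝓡 4) p y - extChartAt (𝓡 4) p p‖) :
    ∀ᶠ y' in 𝓝 y, radialCutoff p s y' = 1 := by
  set e := extChartAt (𝓡 4) p with he
  set Kc : Set M := e.symm '' closedBall (e p) (2 * s) with hKc
  have hsub : closedBall (e p) (2 * s) ⊆ e.target := (closedBall_subset_closedBall hsε).trans hεt
  have hKc_cpt : IsCompact Kc :=
    (isCompact_closedBall (e p) (2 * s)).image_of_continuousOn
      ((continuousOn_extChartAt_symm p).mono hsub)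
  have hsrc : (chartAt (EuclideanSpace ℝ (Fin 4)) p).source = e.source := by
    rw [he, extChartAt_source]
  have hyK : y ∉ Kc := by
    rintro ⟨x, hx, rfl⟩
    have h1 : e.symm x ∈ (chartAt (EuclideanSpace ℝ (Fin 4)) p).source :=
      hsrc ▸ e.map_target (hsub hx)
    have h2 := hy h1
    rw [e.right_inv (hsub hx)] at h2
    rw [mem_closedBall, dist_eq_norm] at hx
    linarith
  filter_upwards [hKc_cpt.isClosed.isOpen_compl.mem_nhds hyK] with y' hy'
  apply radialCutoff_eq_one hs
  intro hy's
  by_contra hlt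
  push Not at hlt
  apply hy'
  refine ⟨e y', ?_, e.left_inv (hsrc ▸ hy's)⟩
  rw [mem_closedBall, dist_eq_norm]
  exact hlt.le

omit [T2Space M] [IsManifold (𝓡 4) ∞ M] in
/-- Near a point of the open chart ball of radius `s` the cut-off is identically `0`.
[folklore] -/
theorem radialCutoff_eventually_eq_zero {s : ℝ} (hs : 0 < s) {y : M}
    (hy : y ∈ (chartAt (EuclideanSpace ℝ (Fin 4)) p).source)
    (hd : ‖extChartAt (𝓡 4) p y - extChartAt (𝓡 4) p p‖ < s) :
    ∀ᶠ y' in 𝓝 y, radialCutoff p s y' = 0 := by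
  have h1 : ContinuousOn (fun y => ‖extChartAt (𝓡 4) p y - extChartAt (𝓡 4) p p‖)
      (chartAt (EuclideanSpace ℝ (Fin 4)) p).source := by
    have := continuousOn_extChartAt (I := 𝓡 4) p
    rw [extChartAt_source] at this
    exact (this.sub continuousOn_const).norm
  have hopen : IsOpen (chartAt (EuclideanSpace ℝ (Fin 4)) p).source := (chartAt _ p).open_source
  have h2 : ∀ᶠ y' in 𝓝 y, ‖extChartAt (𝓡 4) p y' - extChartAt (𝓡 4) p p‖ < s :=
    (h1.continuousAt (hopen.mem_nhds hy)).eventually (gt_mem_nhds hd)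
  filter_upwards [h2, hopen.mem_nhds hy] with y' hy' hy's
  exact radialCutoff_eq_zero hs hy's hy'.le

end Cutoff

/-! ### §2 The completed image of a member is compact -/

section Completed

variable {M : Type} [TopologicalSpace M] [T2Space M] [CompactSpace M]
  [ChartedSpace (EuclideanSpace ℝ (Fin 4)) M] [IsManifold (𝓡 4) ∞ M]
  {p : M} {J : ∀ x : punctured p, TangentSpace (𝓡 4) x →L[ℝ] TangentSpace (𝓡 4) x}
  {u : ℂ → punctured p} {b : ℂ}

omit [ChartedSpace (EuclideanSpace ℝ (Fin 4)) M] [IsManifold (𝓡 4) ∞ M] in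
/-- `K = u(ℂ) ∪ {p}` is the union of the compact core `u(closedBall 0 R)` and the cap image
`pencilCap p u (closedBall 0 R⁻¹)`. [folklore] -/
theorem completedRange_eq (v : ℂ → punctured p) {R : ℝ} (hR : 0 < R) :
    insert p ((fun ξ => (v ξ : M)) '' univ) =
      (fun ξ => (v ξ : M)) '' closedBall 0 R ∪ pencilCap p v '' closedBall 0 R⁻¹ := by
  apply Subset.antisymm
  · rintro y (rfl | ⟨ξ, -, rfl⟩)
    · exact Or.inr ⟨0, mem_closedBall_self (inv_nonneg.2 hR.le), pencilCap_zero⟩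
    · by_cases hξ : ‖ξ‖ ≤ R
      · exact Or.inl ⟨ξ, mem_closedBall_zero_iff.2 hξ, rfl⟩
      · push Not at hξ
        have hξ0 : ξ ≠ 0 := by rintro rfl; rw [norm_zero] at hξ; exact lt_irrefl _ (hR.trans hξ)
        refine Or.inr ⟨ξ⁻¹, ?_, ?_⟩
        · rw [mem_closedBall_zero_iff, norm_inv]
          exact (inv_lt_inv₀ (hR.trans hξ) hR).2 hξ |>.le
        · rw [pencilCap_of_ne_zero (inv_ne_zero hξ0), inv_inv]
  · rintro y (⟨ξ, -, rfl⟩ | ⟨η, -, rfl⟩)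
    · exact Or.inr ⟨ξ, mem_univ _, rfl⟩
    · by_cases hη : η = 0
      · subst hη; rw [pencilCap_zero]; exact mem_insert _ _
      · rw [pencilCap_of_ne_zero hη]; exact Or.inr ⟨η⁻¹, mem_univ _, rfl⟩

/-- **`K = u(ℂ) ∪ {p}` is compact** (hence closed). [folklore] -/
theorem IsPencilPlane.isCompact_completedRange (h : IsPencilPlane J u b) {ε : ℝ} (hε : 0 < ε)
    (hJstd : ∀ x : punctured p, InPuncturedChartBall p ε x →
      ∀ v c : TangentSpace (𝓡 4) x,
        inner ℝ (fderiv ℝ inversion (extChartAt (𝓡 4) p x.1 - extChartAt (𝓡 4) p p)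
          (mfderiv (𝓡 4) 𝓘(ℝ, EuclideanSpace ℝ (Fin 4))
            (fun y : punctured p => extChartAt (𝓡 4) p y.1) x (J x v))) c =
        stdSymplecticForm (fderiv ℝ inversion (extChartAt (𝓡 4) p x.1 - extChartAt (𝓡 4) p p)
          (mfderiv (𝓡 4) 𝓘(ℝ, EuclideanSpace ℝ (Fin 4))
            (fun y : punctured p => extChartAt (𝓡 4) p y.1) x v)) c) :
    IsCompact (insert p ((fun ξ => (u ξ : M)) '' univ)) := by
  rw [completedRange_eq u one_pos]
  refine ((isCompact_closedBall 0 1).image ?_).union ((isCompact_closedBall 0 _).image ?_)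
  · exact continuous_subtype_val.comp h.continuous
  · exact continuous_pencilCap h hε hJstd

end Completed

/-! ### §3 Functions on the punctured manifold, seen on `M` -/

section Extend

variable {M : Type} [TopologicalSpace M] [T2Space M]
  [ChartedSpace (EuclideanSpace ℝ (Fin 4)) M] [IsManifold (𝓡 4) ∞ M] {p : M}

open Classical in
/-- Extension by `0` at `p` of a function on `M ∖ {p}`. [folklore] -/
def extendAtBase (p : M) (A : punctured p → ℂ) (y : M) : ℂ :=
  if h : y = p then 0 else A ⟨y, mem_punctured.2 h⟩

omit [ChartedSpace (EuclideanSpace ℝ (Fin 4)) M] [IsManifold (𝓡 4) ∞ M] in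
/-- The extension agrees with `A` off `p`. [folklore] -/
@[simp] theorem extendAtBase_apply_coe (A : punctured p → ℂ) (x : punctured p) :
    extendAtBase p A x.1 = A x := by
  rw [extendAtBase, dif_neg (mem_punctured.1 x.2)]

omit [ChartedSpace (EuclideanSpace ℝ (Fin 4)) M] [IsManifold (𝓡 4) ∞ M] in
/-- The image in `M` of an open subset of `M ∖ {p}` is open. [folklore] -/
theorem isOpen_image_coe_punctured {S : Set (punctured p)} (hS : IsOpen S) :
    IsOpen (((↑) : punctured p → M) '' S) :=
  (punctured p).2.isOpenEmbedding_subtypeVal.isOpenMap _ hS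

omit [IsManifold (𝓡 4) ∞ M] in
/-- Smoothness on an open subset of `M ∖ {p}` is smoothness of the extension on its image in
`M`. [folklore] -/
theorem contMDiffOn_extendAtBase {A : punctured p → ℂ} {S : Set (punctured p)} (hS : IsOpen S)
    (hA : ContMDiffOn (𝓡 4) 𝓘(ℝ, ℂ) ∞ A S) :
    ContMDiffOn (𝓡 4) 𝓘(ℝ, ℂ) ∞ (extendAtBase p A) (((↑) : punctured p → M) '' S) := by
  rintro y ⟨x, hx, rfl⟩
  have h1 : ContMDiffAt (𝓡 4) 𝓘(ℝ, ℂ) ∞ A x := hA.contMDiffAt (hS.mem_nhds hx)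
  have h2 : (fun x : punctured p => extendAtBase p A x) = A := funext (extendAtBase_apply_coe A)
  have h3 : ContMDiffAt (𝓡 4) 𝓘(ℝ, ℂ) ∞ (fun x : punctured p => extendAtBase p A x) x := by
    rw [h2]; exact h1
  exact (contMDiffAt_subtype_iff.1 h3).contMDiffWithinAt

omit [IsManifold (𝓡 4) ∞ M] in
/-- The differential of the extension at a point of `M ∖ {p}` is that of `A` (the tangent
spaces of the open submanifold and of `M` being the same model space). [folklore] -/
theorem mfderiv_extendAtBase {A : punctured p → ℂ} {S : Set (punctured p)} (hS : IsOpen S)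
    (hA : ContMDiffOn (𝓡 4) 𝓘(ℝ, ℂ) ∞ A S) {x : punctured p} (hx : x ∈ S) :
    mfderiv (𝓡 4) 𝓘(ℝ, ℂ) A x = mfderiv (𝓡 4) 𝓘(ℝ, ℂ) (extendAtBase p A) x.1 := by
  have h2 : A = (extendAtBase p A) ∘ ((↑) : punctured p → M) :=
    (funext (extendAtBase_apply_coe A)).symm.trans rfl
  have hAe : MDifferentiableAt (𝓡 4) 𝓘(ℝ, ℂ) (extendAtBase p A) x.1 :=
    ((contMDiffOn_extendAtBase hS hA).contMDiffAt
      ((isOpen_image_coe_punctured hS).mem_nhds ⟨x, hx, rfl⟩)).mdifferentiableAt (by simp)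
  conv_lhs => rw [h2]
  rw [mfderiv_comp x hAe (Literature.Geometry.Manifold.OpenSubmanifold.mdifferentiableAt_subtype_val x),
    Literature.Geometry.Manifold.OpenSubmanifold.mfderiv_subtype_val]
  rfl

omit [T2Space M] [IsManifold (𝓡 4) ∞ M] in
/-- The open chart ball `{y ∈ source | ‖e y − e p‖ < s}` about `p` in `M`. [folklore] -/
theorem isOpen_chartBall (s : ℝ) :
    IsOpen {y : M | y ∈ (chartAt (EuclideanSpace ℝ (Fin 4)) p).source ∧
      ‖extChartAt (𝓡 4) p y - extChartAt (𝓡 4) p p‖ < s} := by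
  have h1 : ContinuousOn (fun y => ‖extChartAt (𝓡 4) p y - extChartAt (𝓡 4) p p‖)
      (chartAt (EuclideanSpace ℝ (Fin 4)) p).source := by
    have := continuousOn_extChartAt (I := 𝓡 4) p
    rw [extChartAt_source] at this
    exact (this.sub continuousOn_const).norm
  exact h1.isOpen_inter_preimage (chartAt _ p).open_source (isOpen_Iio (a := s))

omit [T2Space M] [IsManifold (𝓡 4) ∞ M] in
/-- A neighbourhood of `p` contains a chart ball. [folklore] -/
theorem exists_chartBall_subset {W : Set M} (hW : W ∈ 𝓝 p) :
    ∃ s : ℝ, 0 < s ∧ ∀ y : M, y ∈ (chartAt (EuclideanSpace ℝ (Fin 4)) p).source →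
      ‖extChartAt (𝓡 4) p y - extChartAt (𝓡 4) p p‖ < s → y ∈ W := by
  have hcont := continuousAt_extChartAt_symm (I := 𝓡 4) p
  have h1 : (extChartAt (𝓡 4) p).symm ⁻¹' W ∈ 𝓝 (extChartAt (𝓡 4) p p) := by
    apply hcont.preimage_mem_nhds
    rwa [extChartAt_to_inv]
  obtain ⟨s, hs, hsub⟩ := Metric.mem_nhds_iff.1 (Filter.inter_mem h1 (extChartAt_target_mem_nhds (I := 𝓡 4) p))
  refine ⟨s, hs, fun y hy hd => ?_⟩
  have hmem : extChartAt (𝓡 4) p y ∈ ball (extChartAt (𝓡 4) p p) s := by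
    rwa [mem_ball, dist_eq_norm]
  have h2 := (hsub hmem).1
  rw [mem_preimage] at h2
  have hy' : y ∈ (extChartAt (𝓡 4) p).source := by rwa [extChartAt_source]
  rwa [(extChartAt (𝓡 4) p).left_inv hy'] at h2

end Extend

/-! ### §4 Universality -/

section Universality

/-- A bounded set of the plane each of whose points (indeed each point of the plane) has a
punctured neighbourhood missing it is finite. [folklore] -/
theorem finite_of_forall_eventually_not_mem {Z : Set ℂ} {T : ℝ} (hZT : Z ⊆ closedBall 0 T)
    (hiso : ∀ z : ℂ, ∀ᶠ z' in 𝓝[≠] z, z' ∉ Z) : Z.Finite := by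
  by_contra hinf
  obtain ⟨z, -, hz⟩ := Set.Infinite.exists_accPt_of_subset_isCompact hinf
    (isCompact_closedBall 0 T) hZT
  rw [accPt_iff_frequently_nhdsNE] at hz
  exact (hz.and_eventually (hiso z)).exists.elim fun z' hz' => hz'.2 hz'.1

/-- A positive lower bound for finitely many positive reals. [folklore] -/
theorem exists_pos_forall_le_of_finite {Z : Set ℂ} (hZ : Z.Finite) (f : ℂ → ℝ)
    (hf : ∀ z ∈ Z, 0 < f z) : ∃ ρ : ℝ, 0 < ρ ∧ ∀ z ∈ Z, ρ ≤ f z := by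
  induction Z, hZ using Set.Finite.induction_on with
  | empty => exact ⟨1, one_pos, fun z hz => hz.elim⟩
  | @insert a S haS hS ih =>
    obtain ⟨ρ, hρ, hρP⟩ := ih fun z hz => hf z (mem_insert_of_mem _ hz)
    refine ⟨min ρ (f a), lt_min hρ (hf a (mem_insert _ _)), fun z hz => ?_⟩
    rcases hz with rfl | hz
    · exact min_le_right _ _
    · exact (min_le_left _ _).trans (hρP z hz)

/-- Products of smooth complex-valued functions on a manifold are smooth (pointwise form).
[folklore] -/
theorem ContMDiffAt.mul_complex {N : Type*} [TopologicalSpace N]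
    [ChartedSpace (EuclideanSpace ℝ (Fin 4)) N] {f g : N → ℂ} {y : N}
    (hf : ContMDiffAt (𝓡 4) 𝓘(ℝ, ℂ) ∞ f y) (hg : ContMDiffAt (𝓡 4) 𝓘(ℝ, ℂ) ∞ g y) :
    ContMDiffAt (𝓡 4) 𝓘(ℝ, ℂ) ∞ (fun x => f x * g x) y := by
  have hmul : ContDiff ℝ ∞ fun x : ℂ × ℂ => x.1 * x.2 := contDiff_mul
  exact hmul.comp_contMDiffAt (hf.prodMk_space hg)

variable {M : Type} [TopologicalSpace M] [T2Space M] [CompactSpace M]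
  [ChartedSpace (EuclideanSpace ℝ (Fin 4)) M] [IsManifold (𝓡 4) ∞ M]
  {p : M} {J : ∀ x : punctured p, TangentSpace (𝓡 4) x →L[ℝ] TangentSpace (𝓡 4) x} {ε : ℝ}
set_option maxHeartbeats 400000 in -- buildfix (bf3-g26): 160k/180k FAIL, 200k PASS at accept time; line-neutral budget line
/-- **Universality of a local pencil family on a homotopy 4-sphere** (Wendl, Prop. 2.53 with
`m = 1`, the universality clause, from the existence of the family). Let `b' ↦ Floc b'`,
`b' ∈ ball b δ`, be members depending smoothly and immersively on `(b', ξ)`, let `r` be a good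
cap radius of `L = Floc b` (`exists_capFst_goodDisc`), and assume the two first-order
properties of the family at the constraint point: `hG` (on small far circles the defining
function `π_p` of the cap of `L` evaluated on the member `Floc b'` is `(b' − b)·Λ` with
`Re Λ > 0`) and `hS` (at far points of `L` the family parameter is positively oriented:
`J ∂_{b'} = c ∂_{b'} + (tangent)` with `Im c > 0`). Then every member of intercept `b` is
`Floc b`. [cite: Wendl2018, Prop. 2.53 with Thm. 2.49 and Thm. 2.46] -/
theorem IsPencilPlane.eq_of_localFamily
    (hM : Nonempty (ContinuousMap.HomotopyEquiv M
      (Metric.sphere (0 : EuclideanSpace ℝ (Fin 5)) 1)))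
    (hJ2 : ∀ (x : punctured p) (v : TangentSpace (𝓡 4) x), J x (J x v) = -v)
    (hJs : ∀ x₀ : punctured p, ContMDiffAt (𝓡 4)
      𝓘(ℝ, EuclideanSpace ℝ (Fin 4) →L[ℝ] EuclideanSpace ℝ (Fin 4)) ∞
      (inTangentCoordinates (𝓡 4) (𝓡 4) (id : punctured p → punctured p) id (fun x => J x) x₀) x₀)
    (hε : 0 < ε)
    (hεt : closedBall (extChartAt (𝓡 4) p p) ε ⊆ (extChartAt (𝓡 4) p).target)
    (hJstd : ∀ x : punctured p, InPuncturedChartBall p ε x →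
      ∀ v c : TangentSpace (𝓡 4) x,
        inner ℝ (fderiv ℝ inversion (extChartAt (𝓡 4) p x.1 - extChartAt (𝓡 4) p p)
          (mfderiv (𝓡 4) 𝓘(ℝ, EuclideanSpace ℝ (Fin 4))
            (fun y : punctured p => extChartAt (𝓡 4) p y.1) x (J x v))) c =
        stdSymplecticForm (fderiv ℝ inversion (extChartAt (𝓡 4) p x.1 - extChartAt (𝓡 4) p p)
          (mfderiv (𝓡 4) 𝓘(ℝ, EuclideanSpace ℝ (Fin 4))
            (fun y : punctured p => extChartAt (𝓡 4) p y.1) x v)) c)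
    {Floc : ℂ → ℂ → punctured p} {b : ℂ} {δ : ℝ} (hδ : 0 < δ)
    (hmem : ∀ b' ∈ ball b δ, IsPencilPlane J (Floc b') b')
    (hsmooth : ContMDiffOn 𝓘(ℝ, ℂ × ℂ) (𝓡 4) ∞ (fun q : ℂ × ℂ => Floc q.1 q.2)
      (ball b δ ×ˢ (univ : Set ℂ)))
    (himm : ∀ q ∈ ball b δ ×ˢ (univ : Set ℂ),
      Injective (mfderiv 𝓘(ℝ, ℂ × ℂ) (𝓡 4) (fun q : ℂ × ℂ => Floc q.1 q.2) q))
    {r : ℝ} (hr : 0 < r)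
    (hdisc : ∀ η : ℂ, η ≠ 0 → ‖η‖ < r →
      InPuncturedChartBall p ε (Floc b η⁻¹) ∧ 1 < ‖(pencilCoord p (Floc b η⁻¹)).1‖)
    (hσ : ContDiffOn ℝ ∞ (capFst p (Floc b)) (ball 0 r))
    (hWr : ContDiffOn ℝ ∞ (capW p (Floc b)) (ball 0 r))
    (hinjσ : InjOn (capFst p (Floc b)) (ball 0 r))
    (hbij : ∀ η ∈ ball (0 : ℂ) r, Bijective (fderiv ℝ (capFst p (Floc b)) η))
    {η₁ : ℝ} (hη₁ : 0 < η₁)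
    (hG : ∀ b' ∈ ball b δ, ∀ η : ℂ, 0 < ‖η‖ → ‖η‖ ≤ η₁ →
      pencilCap p (Floc b') η ∈ capDefDom p (Floc b) r ∧
      ∃ Λ : ℂ, 0 < Λ.re ∧ capDefFn p (Floc b) r (pencilCap p (Floc b') η) = (b' - b) * Λ)
    {Rₛ : ℝ}
    (hS : ∀ ξ : ℂ, Rₛ ≤ ‖ξ‖ → ∀ c v : ℂ,
      mfderiv 𝓘(ℝ, ℂ × ℂ) (𝓡 4) (fun q : ℂ × ℂ => Floc q.1 q.2) (b, ξ) (c, v) =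
        J (Floc b ξ) (mfderiv 𝓘(ℝ, ℂ × ℂ) (𝓡 4) (fun q : ℂ × ℂ => Floc q.1 q.2) (b, ξ) (1, 0)) →
      0 < c.im)
    {u : ℂ → punctured p} (hu : IsPencilPlane J u b) : u = Floc b := by
  classical
  haveI : SecondCountableTopology M :=
    ChartedSpace.secondCountable_of_sigmaCompact (EuclideanSpace ℝ (Fin 4)) M
  by_contra hne
  /- ── notation ── -/
  set L : ℂ → punctured p := Floc b with hL_def
  have hL : IsPencilPlane J L b := hmem b (mem_ball_self hδ)
  set Φ : ℂ × ℂ → punctured p := fun q => Floc q.1 q.2 with hΦ_def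
  set e := extChartAt (𝓡 4) p with he
  set src : Set M := (chartAt (EuclideanSpace ℝ (Fin 4)) p).source with hsrc_def
  set JX : AlmostComplexStructure (𝓡 4) ∞ (punctured p) :=
    AlmostComplexStructure.ofPointwise J hJ2 hJs with hJX
  /- ── Step 1: the constrained intersection at `p` ── -/
  rcases hL.constraintIndex_dichotomy hu hε hJstd hr hdisc hσ hWr hinjσ hbij with hfar | hB
  · exact hne (hu.eq_of_eventually_far_mem_range hL hJ2 hJs hfar)
  obtain ⟨m, hm1, hmiff, ρ₀, hρ₀, hisoP, hwindP⟩ := hB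
  have hm2 : 2 ≤ m := by
    by_contra h
    have : m = 1 := by omega
    exact (hmiff.1 this) rfl
  /- ── Step 2: constants ── -/
  -- `d₁`: the core `L(closedBall 0 r⁻¹)` stays `d₁`-away from `p`
  obtain ⟨d₁, hd₁, hd₁P⟩ := exists_pos_le_norm_extChartAt_sub_of_isCompact (p := p)
    ((isCompact_closedBall (0 : ℂ) r⁻¹).image hL.continuous)
  -- beyond `Ru` the test member is `d₁`-close to `p`
  obtain ⟨Ru, hRu⟩ := hu.exists_forall_norm_le_inPuncturedChartBall hd₁
  set Tu : ℝ := max (max Ru ρ₀⁻¹) 1 with hTu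
  have hTu_pos : 0 < Tu := lt_of_lt_of_le one_pos (le_max_right _ _)
  -- every crossing `u z ∈ L(ℂ)` has `‖z‖ < Tu`
  have hcrossT : ∀ z : ℂ, u z ∈ range L → ‖z‖ < Tu := by
    rintro z ⟨ζ, hζ⟩
    by_contra hzT
    push Not at hzT
    have hz0 : z ≠ 0 := by
      rintro rfl; rw [norm_zero] at hzT; exact lt_irrefl _ (hTu_pos.trans_le hzT)
    have hzρ : ‖z⁻¹‖ ≤ ρ₀ := by
      rw [norm_inv]
      have : ρ₀⁻¹ ≤ ‖z‖ := le_trans (le_trans (le_max_right _ _) (le_max_left _ _)) hzT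
      rwa [inv_le_comm₀ (norm_pos_iff.2 hz0) hρ₀]
    have hne0 := hisoP z⁻¹ (by rw [norm_pos_iff]; exact inv_ne_zero hz0) hzρ
    rw [pencilCap_of_ne_zero (inv_ne_zero hz0), inv_inv] at hne0
    by_cases hζr : ‖ζ‖ ≤ r⁻¹
    · have hRuz : Ru ≤ ‖z‖ := le_trans (le_trans (le_max_left _ _) (le_max_left _ _)) hzT
      have h1 := hRu z hRuz
      have h2 := hd₁P (L ζ) ⟨ζ, mem_closedBall_zero_iff.2 hζr, rfl⟩ (by rw [hζ]; exact h1.1)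
      rw [hζ] at h2
      have h3 : ‖e (u z).1 - e p‖ < d₁ := by
        have := h1.2; rwa [mem_ball, dist_eq_norm] at this
      linarith
    · push Not at hζr
      have hζ0 : ζ ≠ 0 := by
        rintro rfl; rw [norm_zero] at hζr; exact lt_irrefl _ ((inv_pos.2 hr).trans hζr)
      have hmemcap : (L ζ : M) ∈ pencilCap p L '' ball 0 r := by
        refine ⟨ζ⁻¹, ?_, by rw [pencilCap_of_ne_zero (inv_ne_zero hζ0), inv_inv]⟩
        rw [mem_ball_zero_iff, norm_inv]
        rwa [inv_lt_comm₀ (norm_pos_iff.2 hζ0) hr]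
      rw [← capDefFn_zeroSet hdisc hinjσ] at hmemcap
      rw [← hζ] at hne0
      exact hne0 hmemcap.2
  -- `d₀`: the core `u(closedBall 0 Tu)` of the test member stays `d₀`-away from `p`
  obtain ⟨d₀, hd₀, hd₀P⟩ := exists_pos_le_norm_extChartAt_sub_of_isCompact (p := p)
    ((isCompact_closedBall (0 : ℂ) Tu).image hu.continuous)
  -- `s₀`: the chart ball of radius `s₀` lies in `capDefDom`
  obtain ⟨s₀, hs₀, hs₀P⟩ := exists_chartBall_subset (p := p)
    ((isOpen_capDefDom (isOpen_image_capFst hσ hbij)).mem_nhds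
      (base_mem_capDefDom (p := p) (u := L) hr))
  -- `d₂`: the members `Floc b'`, `‖b' − b‖ ≤ δ/2`, at parameters `‖ξ‖ ≤ η₁⁻¹` stay `d₂`-away
  have hcpt₂ : IsCompact (Φ '' (closedBall b (δ / 2) ×ˢ closedBall (0 : ℂ) η₁⁻¹)) := by
    refine ((isCompact_closedBall b (δ / 2)).prod (isCompact_closedBall 0 _)).image_of_continuousOn
      (hsmooth.continuousOn.mono (prod_mono ?_ (subset_univ _)))
    exact closedBall_subset_ball (by linarith)
  obtain ⟨d₂, hd₂, hd₂P⟩ := exists_pos_le_norm_extChartAt_sub_of_isCompact (p := p) hcpt₂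
  -- the scale `s`
  set s : ℝ := min (min (min s₀ d₀) (min d₁ d₂)) ε / 3 with hs_def
  have hs : 0 < s := by
    have : 0 < min (min (min s₀ d₀) (min d₁ d₂)) ε :=
      lt_min (lt_min (lt_min hs₀ hd₀) (lt_min hd₁ hd₂)) hε
    rw [hs_def]; linarith
  have hmin_le : ∀ {a b c d f : ℝ}, min (min (min a b) (min c d)) f ≤ a ∧
      min (min (min a b) (min c d)) f ≤ b ∧ min (min (min a b) (min c d)) f ≤ c ∧
      min (min (min a b) (min c d)) f ≤ d ∧ min (min (min a b) (min c d)) f ≤ f := by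
    intro a b c d f
    refine ⟨?_, ?_, ?_, ?_, min_le_right _ _⟩
    · exact (min_le_left _ _).trans ((min_le_left _ _).trans (min_le_left _ _))
    · exact (min_le_left _ _).trans ((min_le_left _ _).trans (min_le_right _ _))
    · exact (min_le_left _ _).trans ((min_le_right _ _).trans (min_le_left _ _))
    · exact (min_le_left _ _).trans ((min_le_right _ _).trans (min_le_right _ _))
  have h3s₀ : 3 * s ≤ s₀ := by rw [hs_def]; linarith [(hmin_le (a := s₀) (b := d₀) (c := d₁) (d := d₂) (f := ε)).1]
  have h3d₀ : 3 * s ≤ d₀ := by rw [hs_def]; linarith [(hmin_le (a := s₀) (b := d₀) (c := d₁) (d := d₂) (f := ε)).2.1]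
  have h3d₁ : 3 * s ≤ d₁ := by rw [hs_def]; linarith [(hmin_le (a := s₀) (b := d₀) (c := d₁) (d := d₂) (f := ε)).2.2.1]
  have h3d₂ : 3 * s ≤ d₂ := by rw [hs_def]; linarith [(hmin_le (a := s₀) (b := d₀) (c := d₁) (d := d₂) (f := ε)).2.2.2.1]
  have h3ε : 3 * s ≤ ε := by rw [hs_def]; linarith [(hmin_le (a := s₀) (b := d₀) (c := d₁) (d := d₂) (f := ε)).2.2.2.2]
  -- beyond `RL` the leaf member is `s`-close to `p`
  obtain ⟨RL, hRL⟩ := hL.exists_forall_norm_le_inPuncturedChartBall hs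
  set R' : ℝ := max (max RL Rₛ) (max Tu η₁⁻¹) + 1 with hR'
  have hR'RL : RL < R' := by rw [hR']; linarith [le_max_left RL Rₛ, le_max_left (max RL Rₛ) (max Tu η₁⁻¹)]
  have hR'Rs : Rₛ ≤ R' - 1 := by rw [hR']; linarith [le_max_right RL Rₛ, le_max_left (max RL Rₛ) (max Tu η₁⁻¹)]
  have hR'pos : 0 < R' := by rw [hR']; linarith [le_max_left Tu η₁⁻¹, le_max_right (max RL Rₛ) (max Tu η₁⁻¹)]
  -- the box
  obtain ⟨δ', hδ', hδ'δ, hinjD⟩ := exists_injOn_prod_ball (X := punctured p) (Φ := Φ) (b := b)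
    (half_pos hδ) (hsmooth.mono (prod_mono (ball_subset_ball (by linarith)) Subset.rfl))
    (fun q hq => himm q ⟨ball_subset_ball (by linarith) hq.1, mem_univ _⟩) hL.injective R'
  set D : Set (ℂ × ℂ) := ball b δ' ×ˢ ball 0 R' with hD_def
  have hD : IsOpen D := isOpen_ball.prod isOpen_ball
  have hDδ : ∀ q ∈ D, q.1 ∈ ball b δ := fun q hq => ball_subset_ball (by linarith) hq.1
  have hΦD : ContMDiffOn 𝓘(ℝ, ℂ × ℂ) (𝓡 4) ∞ Φ D :=
    hsmooth.mono fun q hq => ⟨hDδ q hq, mem_univ _⟩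
  have himmD : ∀ q ∈ D, Injective (mfderiv 𝓘(ℝ, ℂ × ℂ) (𝓡 4) Φ q) :=
    fun q hq => himm q ⟨hDδ q hq, mem_univ _⟩
  have hbD : b ∈ ball b δ' := mem_ball_self hδ'
  set S : Set (punctured p) := Φ '' D with hS_def
  have hSo : IsOpen S := isOpen_image_of_immersive hD hΦD himmD
  set A : punctured p → ℂ := coreLeafFn Φ D with hA_def
  have hA : ContMDiffOn (𝓡 4) 𝓘(ℝ, ℂ) ∞ A S := contMDiffOn_coreLeafFn hD hΦD hinjD himmD
  set SM : Set M := ((↑) : punctured p → M) '' S with hSM_def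
  have hSMo : IsOpen SM := isOpen_image_coe_punctured hSo
  /- ── Step 3: the glued defining function ── -/
  set ρ : M → ℝ := radialCutoff p s with hρ_def
  have hρs : ContMDiff (𝓡 4) 𝓘(ℝ, ℝ) ∞ ρ := contMDiff_radialCutoff hs (by linarith) hεt
  set πp : M → ℂ := capDefFn p L r with hπp_def
  have hπp : ContMDiffOn (𝓡 4) 𝓘(ℝ, ℂ) ∞ πp (capDefDom p L r) :=
    contMDiffOn_capDefFn (contDiffOn_capSlope hσ hWr hinjσ hbij)
  set At : M → ℂ := extendAtBase p A with hAt_def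
  have hAt : ContMDiffOn (𝓡 4) 𝓘(ℝ, ℂ) ∞ At SM := contMDiffOn_extendAtBase hSo hA
  set π : M → ℂ := fun y => (ρ y : ℂ) * (At y - b) + (1 - (ρ y : ℂ)) * πp y with hπ_def
  set E : Set M := {y | y ∈ src ∧ ‖e y - e p‖ < s} with hE_def
  have hEo : IsOpen E := isOpen_chartBall s
  have hEcap : E ⊆ capDefDom p L r := fun y hy => hs₀P y hy.1 (by linarith [hy.2])
  set U : Set M := SM ∪ E with hU_def
  have hU : IsOpen U := hSMo.union hEo
  have hpE : p ∈ E := ⟨mem_chart_source _ p, by simp [hs]⟩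
  -- smoothness of `π` on `U`
  have hρC : ContMDiff (𝓡 4) 𝓘(ℝ, ℂ) ∞ fun y => (ρ y : ℂ) :=
    Complex.ofRealCLM.contDiff.comp_contMDiff hρs
  have hπU : ContMDiffOn (𝓡 4) 𝓘(ℝ, ℂ) ∞ π U := by
    intro y hy
    apply ContMDiffAt.contMDiffWithinAt
    rcases hy with hyS | hyE
    · -- on `SM`
      have h1 : ContMDiffAt (𝓡 4) 𝓘(ℝ, ℂ) ∞ (fun y => (ρ y : ℂ) * (At y - b)) y :=
        ContMDiffAt.mul_complex (hρC y)
          ((hAt.contMDiffAt (hSMo.mem_nhds hyS)).sub contMDiffAt_const)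
      have h2 : ContMDiffAt (𝓡 4) 𝓘(ℝ, ℂ) ∞ (fun y => (1 - (ρ y : ℂ)) * πp y) y := by
        by_cases hnear : y ∈ src ∧ ‖e y - e p‖ < s₀
        · exact ContMDiffAt.mul_complex (contMDiffAt_const.sub (hρC y))
            (hπp.contMDiffAt ((isOpen_capDefDom (isOpen_image_capFst hσ hbij)).mem_nhds
              (hs₀P y hnear.1 hnear.2)))
        · have hfar : y ∈ src → 2 * s < ‖e y - e p‖ := fun hy' => by
            by_contra hlt
            push Not at hlt
            exact hnear ⟨hy', by linarith⟩
          have hev := radialCutoff_eventually_eq_one hs (by linarith) hεt hfar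
          have hev' : (fun y => (1 - (ρ y : ℂ)) * πp y) =ᶠ[𝓝 y] fun _ => 0 := by
            filter_upwards [hev] with y' hy'
            simp [hρ_def, hy']
          exact contMDiffAt_const.congr_of_eventuallyEq hev'
      exact h1.add h2
    · -- on `E`
      have hev := radialCutoff_eventually_eq_zero hs hyE.1 hyE.2
      have hev' : π =ᶠ[𝓝 y] πp := by
        filter_upwards [hev] with y' hy'
        simp [hπ_def, hρ_def, hy']
      exact (hπp.contMDiffAt ((isOpen_capDefDom (isOpen_image_capFst hσ hbij)).mem_nhds
        (hEcap hyE))).congr_of_eventuallyEq hev'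
  /- ── Step 4: the zero set of `π` in `U` is `K = L(ℂ) ∪ {p}` ── -/
  set K : Set M := insert p ((fun ξ => (L ξ : M)) '' univ) with hK_def
  have hKc : IsCompact K := hL.isCompact_completedRange hε hJstd
  -- far points of `L` lie in `E`, core points in `SM` with `A = b`
  have hLfar : ∀ ξ : ℂ, RL ≤ ‖ξ‖ → (L ξ : M) ∈ E := fun ξ hξ => by
    have h := hRL ξ hξ
    refine ⟨h.1, ?_⟩
    have := h.2; rwa [mem_ball, dist_eq_norm] at this
  have hLcore : ∀ ξ : ℂ, ‖ξ‖ < R' → (b, ξ) ∈ D := fun ξ hξ => ⟨hbD, mem_ball_zero_iff.2 hξ⟩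
  have hAL : ∀ ξ : ℂ, ‖ξ‖ < R' → A (L ξ) = b := fun ξ hξ =>
    coreLeafFn_apply hinjD (hLcore ξ hξ)
  have hLSM : ∀ ξ : ℂ, ‖ξ‖ < R' → (L ξ : M) ∈ SM := fun ξ hξ =>
    ⟨L ξ, ⟨(b, ξ), hLcore ξ hξ, rfl⟩, rfl⟩
  have hKU : K ⊆ U := by
    rintro y (hyp | ⟨ξ, -, rfl⟩)
    · rw [hyp]; exact Or.inr hpE
    · by_cases hξ : ‖ξ‖ < R'
      · exact Or.inl (hLSM ξ hξ)
      · exact Or.inr (hLfar ξ (le_trans hR'RL.le (not_lt.1 hξ)))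
  -- a point of `L(ℂ)` which is `2s`-close to `p` is a cap point of `L` in the good disc
  have hLcap : ∀ ξ : ℂ, (L ξ : M) ∈ src → ‖e (L ξ) - e p‖ < d₁ →
      (L ξ : M) ∈ pencilCap p L '' ball 0 r := fun ξ hξs hξd => by
    have hξr : r⁻¹ < ‖ξ‖ := by
      by_contra hle
      push Not at hle
      have := hd₁P (L ξ) ⟨ξ, mem_closedBall_zero_iff.2 hle, rfl⟩ hξs
      linarith
    have hξ0 : ξ ≠ 0 := by
      rintro rfl; rw [norm_zero] at hξr; exact lt_irrefl _ ((inv_pos.2 hr).trans hξr)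
    refine ⟨ξ⁻¹, ?_, by rw [pencilCap_of_ne_zero (inv_ne_zero hξ0), inv_inv]⟩
    rw [mem_ball_zero_iff, norm_inv]
    rwa [inv_lt_comm₀ (norm_pos_iff.2 hξ0) hr]
  have hcapK : pencilCap p L '' ball 0 r ⊆ K := by
    rintro y ⟨η, -, rfl⟩
    by_cases hη : η = 0
    · subst hη; rw [pencilCap_zero]; exact mem_insert _ _
    · rw [pencilCap_of_ne_zero hη]; exact Or.inr ⟨η⁻¹, mem_univ _, rfl⟩
  -- `π` vanishes on `K`
  have hρ01 : ∀ y, 0 ≤ ρ y ∧ ρ y ≤ 1 := fun y => ⟨radialCutoff_nonneg s y, radialCutoff_le_one s y⟩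
  have hπK : ∀ y ∈ K, π y = 0 := by
    rintro y (hyp | ⟨ξ, -, rfl⟩)
    · rw [hyp]
      have hρp : ρ p = 0 := radialCutoff_eq_zero hs (mem_chart_source _ p)
        (by rw [sub_self, norm_zero]; exact hs.le)
      have hπpp : πp p = 0 := by simp [hπp_def, capDefFn]
      simp [hπ_def, hρp, hπpp]
    · -- first term vanishes
      have h1 : (ρ (L ξ) : ℂ) * (At (L ξ) - b) = 0 := by
        by_cases hξ : ‖ξ‖ < R'
        · have : At (L ξ) = b := by rw [hAt_def, extendAtBase_apply_coe]; exact hAL ξ hξ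
          rw [this, sub_self, mul_zero]
        · have hfarξ := hLfar ξ (le_trans hR'RL.le (not_lt.1 hξ))
          have : ρ (L ξ) = 0 := radialCutoff_eq_zero hs hfarξ.1 hfarξ.2.le
          rw [this]; simp
      -- second term vanishes
      have h2 : (1 - (ρ (L ξ) : ℂ)) * πp (L ξ) = 0 := by
        by_cases hnear : (L ξ : M) ∈ src ∧ ‖e (L ξ) - e p‖ < 2 * s
        · have hcap := hLcap ξ hnear.1 (by linarith [hnear.2])
          rw [← capDefFn_zeroSet hdisc hinjσ] at hcap
          rw [show πp (L ξ) = 0 from hcap.2, mul_zero]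
        · have : ρ (L ξ) = 1 := by
            apply radialCutoff_eq_one hs
            intro hsrc'
            by_contra hlt; push Not at hlt
            exact hnear ⟨hsrc', hlt⟩
          rw [this]; simp
      change (ρ (L ξ) : ℂ) * (At (L ξ) - b) + (1 - (ρ (L ξ) : ℂ)) * πp (L ξ) = 0
      rw [h1, h2, add_zero]
  -- conversely, zeros of `π` in `U` lie on `K`
  have hSnear : ∀ q ∈ D, (Φ q : M) ∈ src → ‖e (Φ q) - e p‖ ≤ 2 * s → η₁⁻¹ < ‖q.2‖ := by
    intro q hq hqs hqd
    by_contra hle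
    push Not at hle
    have hmem : Φ q ∈ Φ '' (closedBall b (δ / 2) ×ˢ closedBall (0 : ℂ) η₁⁻¹) :=
      ⟨q, ⟨(ball_subset_closedBall.trans (closedBall_subset_closedBall hδ'δ)) hq.1,
        mem_closedBall_zero_iff.2 hle⟩, rfl⟩
    have := hd₂P (Φ q) hmem hqs
    linarith
  have hAtΦ : ∀ q ∈ D, At (Φ q) = q.1 := fun q hq => by
    rw [hAt_def, extendAtBase_apply_coe]; exact coreLeafFn_apply hinjD hq
  have hZ1 : ∀ q ∈ D, π (Φ q) = 0 → q.1 = b := by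
    intro q hq hπ0
    have hπq : π (Φ q) = (ρ (Φ q) : ℂ) * (q.1 - b) + (1 - (ρ (Φ q) : ℂ)) * πp (Φ q) := by
      simp only [hπ_def, hAtΦ q hq]
    by_cases hnear : (Φ q : M) ∈ src ∧ ‖e (Φ q) - e p‖ ≤ 2 * s
    · have hq2 : η₁⁻¹ < ‖q.2‖ := hSnear q hq hnear.1 hnear.2
      have hq20 : q.2 ≠ 0 := by
        rintro h0; rw [h0, norm_zero] at hq2; exact lt_irrefl _ ((inv_pos.2 hη₁).trans hq2)
      have hηpos : 0 < ‖q.2⁻¹‖ := by rw [norm_pos_iff]; exact inv_ne_zero hq20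
      have hηle : ‖q.2⁻¹‖ ≤ η₁ := by
        rw [norm_inv]
        exact ((inv_lt_comm₀ hη₁ ((inv_pos.2 hη₁).trans hq2)).1 hq2).le
      obtain ⟨-, Λ, hΛ, hGq⟩ := hG q.1 (hDδ q hq) q.2⁻¹ hηpos hηle
      have hcapq : pencilCap p (Floc q.1) q.2⁻¹ = (Φ q : M) := by
        rw [pencilCap_of_ne_zero (inv_ne_zero hq20), inv_inv]
      rw [hcapq] at hGq
      rw [hπq, show πp (Φ q) = (q.1 - b) * Λ from hGq] at hπ0
      have hfac : (q.1 - b) * ((ρ (Φ q) : ℂ) + (1 - (ρ (Φ q) : ℂ)) * Λ) = 0 := by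
        rw [← hπ0]; ring
      rcases mul_eq_zero.1 hfac with h | h
      · exact sub_eq_zero.1 h
      · exfalso
        have hre : ρ (Φ q : M) + (1 - ρ (Φ q : M)) * Λ.re = 0 := by
          have := congrArg Complex.re h
          simpa [Complex.mul_re] using this
        have h01 := hρ01 (Φ q : M)
        have hprod : 0 ≤ (1 - ρ (Φ q : M)) * Λ.re := mul_nonneg (sub_nonneg.2 h01.2) hΛ.le
        have hρ0 : ρ (Φ q : M) = 0 := by linarith [h01.1]
        rw [hρ0, zero_add, sub_zero, one_mul] at hre
        exact absurd hre hΛ.ne'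
    · have hρ1 : ρ (Φ q) = 1 := by
        apply radialCutoff_eq_one hs
        intro hsrc'
        by_contra hlt; push Not at hlt
        exact hnear ⟨hsrc', hlt.le⟩
      rw [hπq, hρ1] at hπ0
      simp only [Complex.ofReal_one, one_mul, sub_self, zero_mul, add_zero] at hπ0
      exact sub_eq_zero.1 hπ0
  have hzero : {y | y ∈ U ∧ π y = 0} = K := by
    apply Subset.antisymm
    · rintro y ⟨hyU, hπy⟩
      rcases hyU with ⟨x, ⟨q, hq, rfl⟩, rfl⟩ | hyE
      · have hq1 := hZ1 q hq hπy
        refine Or.inr ⟨q.2, mem_univ _, ?_⟩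
        change (Floc b q.2 : M) = (Floc q.1 q.2 : M)
        rw [hq1]
      · have hρ0 : ρ y = 0 := radialCutoff_eq_zero hs hyE.1 hyE.2.le
        have hπy' : πp y = 0 := by
          have : π y = πp y := by simp [hπ_def, hρ0]
          rw [← this]; exact hπy
        have hmem : y ∈ {y | y ∈ capDefDom p L r ∧ capDefFn p L r y = 0} := ⟨hEcap hyE, hπy'⟩
        rw [capDefFn_zeroSet hdisc hinjσ] at hmem
        exact hcapK hmem
    · intro y hy
      exact ⟨hKU hy, hπK y hy⟩
  have hZc : IsClosed {y | y ∈ U ∧ π y = 0} := by rw [hzero]; exact hKc.isClosed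
  /- ── Step 5: crossings of the test member with `K` ── -/
  set uM : ℂ → M := fun z => (u z : M) with huM_def
  have huMs : ContMDiff 𝓘(ℝ, ℂ) (𝓡 4) ∞ uM := contMDiff_subtype_val.comp hu.contMDiff
  set Z : Set ℂ := {z | uM z ∈ U ∧ π (uM z) = 0} with hZ_def
  have hZiff : ∀ z, z ∈ Z ↔ u z ∈ range L := by
    intro z
    have h1 : z ∈ Z ↔ uM z ∈ K := by
      rw [← hzero]; exact Iff.rfl
    rw [h1, hK_def, mem_insert_iff]
    constructor
    · rintro (h | ⟨ξ, -, hξ⟩)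
      · exact absurd h (mem_punctured.1 (u z).2)
      · exact ⟨ξ, Subtype.ext hξ⟩
    · rintro ⟨ξ, hξ⟩
      exact Or.inr ⟨ξ, mem_univ _, by show (L ξ : M) = (u z : M); rw [hξ]⟩
  have hZT : Z ⊆ closedBall 0 Tu := fun z hz =>
    mem_closedBall_zero_iff.2 (hcrossT z ((hZiff z).1 hz)).le
  have hZcl : IsClosed Z := by
    have : Z = u ⁻¹' range L := Set.ext fun z => hZiff z
    rw [this]; exact hL.isClosedEmbedding.isClosed_range.preimage hu.continuous
  -- at a crossing: the leaf parameter is in the core, and the point is `3s`-far from `p`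
  have hcross : ∀ z ∈ Z, ∃ ζ : ℂ, u z = L ζ ∧ ‖ζ‖ < RL ∧
      ((u z : M) ∈ src → 3 * s ≤ ‖e (u z) - e p‖) := by
    intro z hz
    obtain ⟨ζ, hζ⟩ := (hZiff z).1 hz
    have hzT := hcrossT z ⟨ζ, hζ⟩
    have hfarz : (u z : M) ∈ src → 3 * s ≤ ‖e (u z) - e p‖ := fun hsrc' =>
      le_trans h3d₀ (hd₀P (u z) ⟨z, mem_closedBall_zero_iff.2 hzT.le, rfl⟩ hsrc')
    refine ⟨ζ, hζ.symm, ?_, hfarz⟩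
    by_contra hle
    push Not at hle
    have h := hLfar ζ hle
    rw [hζ] at h
    have := hfarz h.1
    linarith [h.2]
  /- ── Step 6: positivity of the leaf function along the box ── -/
  have hWpre : IsPreconnected S :=
    ((convex_ball b δ').isPreconnected.prod (convex_ball (0 : ℂ) R').isPreconnected).image _
      hΦD.continuousOn
  have hsurjA : ∀ y ∈ S, Surjective (mfderiv (𝓡 4) 𝓘(ℝ, ℂ) A y) := by
    rintro y ⟨q, hq, rfl⟩
    exact surjective_mfderiv_coreLeafFn hD hΦD hinjD himmD hq
  have hholq : ∀ q ∈ D, ∀ w : ℂ, mfderiv 𝓘(ℝ, ℂ × ℂ) (𝓡 4) Φ q (0, Complex.I * w) =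
      JX (Φ q) (mfderiv 𝓘(ℝ, ℂ × ℂ) (𝓡 4) Φ q (0, w)) := by
    rintro ⟨b', ξ⟩ hq w
    rw [← mfderiv_slice_apply_of_mem hD hΦD hq, ← mfderiv_slice_apply_of_mem hD hΦD hq]
    exact (hmem b' (hDδ _ hq)).isJHolomorphic ξ w
  have hkerA : ∀ y ∈ S, ∀ v, mfderiv (𝓡 4) 𝓘(ℝ, ℂ) A y v = 0 →
      mfderiv (𝓡 4) 𝓘(ℝ, ℂ) A y (JX y v) = 0 := by
    rintro y ⟨q, hq, rfl⟩ v hv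
    obtain ⟨w, rfl⟩ := (mfderiv_coreLeafFn_eq_zero_iff hD hΦD hinjD himmD hq v).1 hv
    rw [← hholq q hq w]
    exact mfderiv_coreLeafFn_slice_eq_zero hD hΦD hinjD himmD hq _
  have hdAΦ : ∀ q ∈ D, ∀ c v : ℂ, (show ℂ from mfderiv (𝓡 4) 𝓘(ℝ, ℂ) A (Φ q)
      (mfderiv 𝓘(ℝ, ℂ × ℂ) (𝓡 4) Φ q (c, v))) = c := by
    intro q hq c v
    have h := congrArg (fun T : (ℂ × ℂ) →L[ℝ] ℂ => T (c, v))
      (mfderiv_coreLeafFn_comp hD hΦD hinjD himmD hq)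
    exact h
  -- the far reference point `ξs = R' − 1`
  set ξs : ℂ := ((R' - 1 : ℝ) : ℂ) with hξs
  have hR'1 : 1 < R' := by
    rw [hR']
    linarith [le_max_left Tu η₁⁻¹, le_max_right (max RL Rₛ) (max Tu η₁⁻¹), hTu_pos]
  have hξs_norm : ‖ξs‖ = R' - 1 := by
    rw [hξs, Complex.norm_real, Real.norm_eq_abs, abs_of_nonneg (by linarith)]
  have hqs : (b, ξs) ∈ D := hLcore ξs (by rw [hξs_norm]; linarith)
  -- the sign predicate
  have hPs : ∀ v, mfderiv (𝓡 4) 𝓘(ℝ, ℂ) A (Φ (b, ξs)) v ≠ 0 →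
      0 < ((show ℂ from mfderiv (𝓡 4) 𝓘(ℝ, ℂ) A (Φ (b, ξs)) (JX _ v)) *
        conj (show ℂ from mfderiv (𝓡 4) 𝓘(ℝ, ℂ) A (Φ (b, ξs)) v)).im := by
    have hν : (show ℂ from mfderiv (𝓡 4) 𝓘(ℝ, ℂ) A (Φ (b, ξs))
        (mfderiv 𝓘(ℝ, ℂ × ℂ) (𝓡 4) Φ (b, ξs) (1, 0))) = 1 := hdAΦ _ hqs 1 0
    rw [posAt_iff JX (hkerA _ ⟨_, hqs, rfl⟩)
      (v₀ := mfderiv 𝓘(ℝ, ℂ × ℂ) (𝓡 4) Φ (b, ξs) (1, 0))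
      (fun h0 => absurd (hν.symm.trans h0 : (1 : ℂ) = 0) one_ne_zero)]
    obtain ⟨⟨c, v⟩, hcv⟩ := (bijective_mfderiv_of_injective (himmD _ hqs)).2
      (JX (Φ (b, ξs)) (mfderiv 𝓘(ℝ, ℂ × ℂ) (𝓡 4) Φ (b, ξs) (1, 0)))
    have hc : 0 < c.im := hS ξs (by rw [hξs_norm]; exact hR'Rs) c v hcv
    have h1 : (show ℂ from mfderiv (𝓡 4) 𝓘(ℝ, ℂ) A (Φ (b, ξs))
        (JX _ (mfderiv 𝓘(ℝ, ℂ × ℂ) (𝓡 4) Φ (b, ξs) (1, 0)))) = c := by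
      rw [← hcv]; exact hdAΦ _ hqs c v
    rw [h1, hν, map_one, mul_one]
    exact hc
  have hPall : ∀ q ∈ D, ∀ v, mfderiv (𝓡 4) 𝓘(ℝ, ℂ) A (Φ q) v ≠ 0 →
      0 < ((show ℂ from mfderiv (𝓡 4) 𝓘(ℝ, ℂ) A (Φ q) (JX _ v)) *
        conj (show ℂ from mfderiv (𝓡 4) 𝓘(ℝ, ℂ) A (Φ q) v)).im := fun q hq =>
    (posAt_iff_posAt_of_isPreconnected JX hSo hWpre hA hsurjA hkerA ⟨q, hq, rfl⟩
      ⟨_, hqs, rfl⟩).2 hPs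
  /- ── Step 7: local index at each crossing ── -/
  have hlocal : ∀ z ∈ Z, ∃ r₁ : ℝ, 0 < r₁ ∧
      (∀ z', 0 < ‖z' - z‖ → ‖z' - z‖ ≤ r₁ → z' ∉ Z) ∧
      ∀ ρ', 0 < ρ' → ρ' ≤ r₁ → 1 ≤ wind (fun t => π (uM (circleLoop z ρ' t))) := by
    intro z hz
    obtain ⟨ζ, hζ, hζR, hfarz⟩ := hcross z hz
    have hζR' : ‖ζ‖ < R' := hζR.trans hR'RL
    have hqz : (b, ζ) ∈ D := hLcore ζ hζR'
    have hcr : u z = Φ (b, ζ) := hζ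
    rcases corePositivity_dichotomy JX isOpen_ball isOpen_ball hΦD hinjD himmD hbD
        (mem_ball_zero_iff.2 hζR') hL.contMDiff hL.isJHolomorphic hu.contMDiff
        hu.isJHolomorphic hcr with hC1 | ⟨r₀z, hr₀z, hisoz, hposz, -⟩
    · exfalso
      apply hne
      apply hu.eq_of_frequently_mem_range hL hJ2 hJs (ξ₀ := z)
      have hev : ∀ᶠ z' in 𝓝 z, u z' ∈ range L := by
        filter_upwards [hC1] with z' hz'
        have hmem' : u z' ∈ {y | y ∈ Φ '' (ball b δ' ×ˢ ball 0 R') ∧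
            coreLeafFn Φ (ball b δ' ×ˢ ball 0 R') y = b} := hz'
        rw [coreLeafFn_levelSet hinjD hbD] at hmem'
        obtain ⟨⟨b₁, ξ⟩, ⟨hb₁, -⟩, hq⟩ := hmem'
        rw [mem_singleton_iff] at hb₁
        subst hb₁
        exact ⟨ξ, hq⟩
      exact Filter.Eventually.frequently (nhdsWithin_le_nhds hev)
    · have hρ1 : ∀ᶠ y' in 𝓝 (uM z), ρ y' = 1 :=
        radialCutoff_eventually_eq_one hs (by linarith) hεt fun h' => by linarith [hfarz h']
      have hform : ∀ᶠ z' in 𝓝 z, π (uM z') = A (u z') - b := by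
        filter_upwards [huMs.continuous.continuousAt.eventually hρ1] with z' hz'
        have hz'' : ρ (uM z') = 1 := hz'
        simp only [hπ_def, huM_def] at hz'' ⊢
        rw [hz'', hAt_def, extendAtBase_apply_coe]
        simp
      obtain ⟨r₂, hr₂, hr₂P⟩ := Metric.eventually_nhds_iff_ball.1 hform
      refine ⟨min r₀z (r₂ / 2), lt_min hr₀z (half_pos hr₂), fun z' hz'0 hz'r hz'Z => ?_,
        fun ρ' hρ' hρ'r => ?_⟩
      · obtain ⟨ζ', hζ', hζ'R, -⟩ := hcross z' hz'Z
        apply (hisoz z' hz'0 (hz'r.trans (min_le_left _ _))).2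
        rw [hζ']
        exact hAL ζ' (hζ'R.trans hR'RL)
      · have hP := hPall _ hqz
        have hν : (show ℂ from mfderiv (𝓡 4) 𝓘(ℝ, ℂ) A (Φ (b, ζ))
            (mfderiv 𝓘(ℝ, ℂ × ℂ) (𝓡 4) Φ (b, ζ) (1, 0))) = 1 := hdAΦ _ hqz 1 0
        have hν0 : mfderiv (𝓡 4) 𝓘(ℝ, ℂ) A (Φ (b, ζ))
            (mfderiv 𝓘(ℝ, ℂ × ℂ) (𝓡 4) Φ (b, ζ) (1, 0)) ≠ 0 :=
          fun h0 => absurd (hν.symm.trans h0 : (1 : ℂ) = 0) one_ne_zero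
        have h1 := hposz (mfderiv 𝓘(ℝ, ℂ × ℂ) (𝓡 4) Φ (b, ζ) (1, 0)) hν0 (hP _ hν0) ρ' hρ'
          (hρ'r.trans (min_le_left _ _))
        have heq : (fun t => π (uM (circleLoop z ρ' t))) =
            fun t => A (u (circleLoop z ρ' t)) - b := by
          funext t
          apply hr₂P
          rw [mem_ball, dist_eq_norm, norm_circleLoop_sub_center, abs_of_pos hρ']
          linarith [min_le_right r₀z (r₂ / 2)]
        rw [heq]
        exact h1
  -- finiteness of the crossings
  have hZiso : ∀ z : ℂ, ∀ᶠ z' in 𝓝[≠] z, z' ∉ Z := by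
    intro z
    by_cases hz : z ∈ Z
    · obtain ⟨r₁, hr₁, hiso1, -⟩ := hlocal z hz
      have h1 : ∀ᶠ z' in 𝓝[≠] z, z' ≠ z := self_mem_nhdsWithin
      have h2 : ∀ᶠ z' in 𝓝 z, ‖z' - z‖ ≤ r₁ := by
        filter_upwards [Metric.closedBall_mem_nhds z hr₁] with z' hz'
        rwa [mem_closedBall, dist_eq_norm] at hz'
      filter_upwards [h1, nhdsWithin_le_nhds h2] with z' h1' h2'
      exact hiso1 z' (norm_pos_iff.2 (sub_ne_zero.2 h1')) h2'
    · exact nhdsWithin_le_nhds (hZcl.isOpen_compl.mem_nhds hz)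
  have hZfin : Z.Finite := finite_of_forall_eventually_not_mem hZT hZiso
  /- ── Step 8: the homological count ── -/
  obtain ⟨c, hc⟩ := sphere_zeroSetIndex_factorsThroughHomology_of_isClosed M π U hU hπU hZc
  obtain ⟨r₀, hr₀', hcount⟩ := hc uM (pencilCap p u) (hu.capSphere hε hJstd) huMs
    (hu.contMDiff_pencilCap hε hJstd) (fun z hz => pencilCap_of_ne_zero hz)
    (fun q hq => twoChartSphere_apply_of_coordNeZero_zero q hq)
    (fun q hq => twoChartSphere_apply_of_coordNeZero_one q hq) hZfin
  -- a common small radius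
  choose r₁ hr₁ hiso₁ hwind₁ using hlocal
  obtain ⟨ρ₁, hρ₁, hρ₁P⟩ := exists_pos_forall_le_of_finite hZfin
    (fun z => if hz : z ∈ Z then r₁ z hz else 1) fun z hz => by
      simp only [dif_pos hz]; exact hr₁ z hz
  obtain ⟨θ, hθ, hθP⟩ : ∃ θ : ℝ, 0 < θ ∧ ∀ η : ℂ, ‖η‖ < θ → pencilCap p u η ∈ E := by
    have hc0 : ContinuousAt (pencilCap p u) 0 := (hu.continuous_pencilCap hε hJstd).continuousAt
    have h1 : pencilCap p u ⁻¹' E ∈ 𝓝 (0 : ℂ) :=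
      hc0.preimage_mem_nhds (by rw [pencilCap_zero]; exact hEo.mem_nhds hpE)
    obtain ⟨θ, hθ, hθP⟩ := Metric.mem_nhds_iff.1 h1
    exact ⟨θ, hθ, fun η hη => hθP (mem_ball_zero_iff.2 hη)⟩
  set r' : ℝ := min (min r₀ ρ₀) (min θ ρ₁) / 2 with hr'_def
  have hmin4 : 0 < min (min r₀ ρ₀) (min θ ρ₁) := lt_min (lt_min hr₀' hρ₀) (lt_min hθ hρ₁)
  have hr'pos : 0 < r' := by rw [hr'_def]; linarith
  have hr'r₀ : r' ≤ r₀ := by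
    rw [hr'_def]; linarith [min_le_left (min r₀ ρ₀) (min θ ρ₁), min_le_left r₀ ρ₀]
  have hr'ρ₀ : r' ≤ ρ₀ := by
    rw [hr'_def]; linarith [min_le_left (min r₀ ρ₀) (min θ ρ₁), min_le_right r₀ ρ₀]
  have hr'θ : r' < θ := by
    rw [hr'_def]; linarith [min_le_right (min r₀ ρ₀) (min θ ρ₁), min_le_left θ ρ₁]
  have hr'ρ₁ : r' ≤ ρ₁ := by
    rw [hr'_def]; linarith [min_le_right (min r₀ ρ₀) (min θ ρ₁), min_le_right θ ρ₁]
  have hEqn := hcount r' hr'pos hr'r₀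
  rw [addMonoidHom_apply_eq_zero_of_homotopyEquiv M hM] at hEqn
  -- the constrained term
  have hWset : {w : ℂ | w = 0 ∧ pencilCap p u w ∈ U ∧ π (pencilCap p u w) = 0} = {0} := by
    ext w
    simp only [mem_setOf_eq, mem_singleton_iff]
    constructor
    · exact fun h => h.1
    · rintro rfl
      rw [pencilCap_zero]
      exact ⟨rfl, hKU (mem_insert _ _), hπK p (mem_insert _ _)⟩
  rw [hWset, finsum_mem_singleton] at hEqn
  have hvterm : wind (fun t => π (pencilCap p u (circleLoop 0 r' t))) = (m : ℤ) - 1 := by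
    have heq : (fun t => π (pencilCap p u (circleLoop 0 r' t))) =
        fun t => capDefFn p L r (pencilCap p u (circleLoop 0 r' t)) := by
      funext t
      have hin : pencilCap p u (circleLoop 0 r' t) ∈ E :=
        hθP _ (by rw [norm_circleLoop_zero hr'pos]; exact hr'θ)
      have hρ0 : ρ (pencilCap p u (circleLoop 0 r' t)) = 0 :=
        radialCutoff_eq_zero hs hin.1 hin.2.le
      show (ρ _ : ℂ) * (At _ - b) + (1 - (ρ _ : ℂ)) * πp _ = capDefFn p L r _
      rw [hρ0, Complex.ofReal_zero, zero_mul, zero_add, sub_zero, one_mul]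
    rw [heq]
    exact hwindP r' hr'pos hr'ρ₀
  -- the core terms are `≥ 1`
  have huterm : 0 ≤ ∑ᶠ z ∈ Z, wind (fun t => π (uM (circleLoop z r' t))) := by
    refine finsum_nonneg fun z => finsum_nonneg fun hz => ?_
    have hle : ρ₁ ≤ r₁ z hz := by
      have := hρ₁P z hz
      rwa [dif_pos hz] at this
    exact le_trans zero_le_one (hwind₁ z hz r' hr'pos (hr'ρ₁.trans hle))
  rw [hvterm] at hEqn
  have hm' : (2 : ℤ) ≤ (m : ℤ) := by exact_mod_cast hm2
  linarith

end Universality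

end Literature.Geometry.Symplectic
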